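import Literature.AlgebraicGeometry.Motives.AbelianVariety
import Mathlib.Data.Fintype.BigOperators
import HarnessLib

/-!
# Complete reducibility up to isogeny WITH OPERATORS: decomposition into `R`-simple pieces

An abelian variety `X` over a field `K` with an action `φ : R →+* End X` of a (semi)ring `R`
(a finite group through its group ring, an order of a CM field acting by complex multiplication,
…) is **`R`-simple** if it has no `R`-stable abelian subvariety `w : W ↪ X` — `W` with an action
`ω : R →+* End W` making `w` equivariant — of dimension `0 < dim W < dim X` (the tree's
`AbelianVariety.IsSimple` is the case of the trivial action; the predicate is written out in the
statements, binders explicit).  Granted an **equivariant Poincaré splitting** `hP` — every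
`R`-stable abelian subvariety `i : Y ↪ X` with `0 < dim Y < dim X` has an `R`-stable
quasi-complement: `Z` with `R`-action `χ`, `dim Z < dim X`, equivariant `j : Z ⟶ X`, `h : X ⟶ Y`,
`t : X ⟶ Z` and `M ≥ 1` with `i ≫ h = M`, `j ≫ t = M`, `i ≫ t = 0`, `j ≫ h = 0`,
`h ≫ i + t ≫ j = M` (the identities of `X ≅ Y ⊕ Z` in the isogeny category, cleared of
denominators; supplied over every perfect field by
`Motives/AbelianVarietyPoincareEquivariantPerfectField`) — every `(X, φ)` decomposes up to
isogeny into `R`-SIMPLE pieces, equivariantly: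

* `AbelianVariety.exists_equivariant_quasiDecomposition_of_splitting` — finitely many abelian
  varieties `Sᵢ` with `R`-actions `χᵢ`, each `R`-simple, EQUIVARIANT morphisms `ιᵢ : Sᵢ ⟶ X`,
  `πᵢ : X ⟶ Sᵢ` and `N ≥ 1` with `ιᵢ ≫ πᵢ = N`, `ιᵢ ≫ πⱼ = 0` (`i ≠ j`), `∑ᵢ πᵢ ≫ ιᵢ = N` — the
  shape of the tree's `exists_quasiDecomposition_of_isogeny_biprod`
  (`Motives/AbelianVarietyEndAlgebraSemisimpleProofs`, trivial action) with the action carried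
  along.  Proof: induction on `dim X`; an `R`-simple `X` is its own decomposition; otherwise split
  off an `R`-stable `Y` by `hP` and merge decompositions `(ι¹, π¹, N₁)` of `Y` and `(ι², π², N₂)`
  of `Z` as `ι = N₂ (ι¹ ≫ i)`, `N₁ (ι² ≫ j)`, `π = h ≫ π¹`, `t ≫ π²`, `N = N₁ N₂ M`.

This is Poincaré's complete reducibility theorem in the category of abelian varieties with
`R`-action up to isogeny (Mumford §19 Thm. 1 and Cor. 1 with operators; for a finite group
Lange–Rodríguez Thm. 2.7.1 / Cor. 2.7.2 «`G`-simple» decomposition).  Everything is proved; no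
definition, no named fact (D-0026).

## References

* D. Mumford, *Abelian Varieties* (1970), §19 Thm. 1 and Cor. 1 (pp. 173–174). [MumfordAV1970]
* H. Lange, R. E. Rodríguez, *Decomposition of Jacobians by Prym Varieties*, LNM 2310 (2022),
  §2.7 (Thm. 2.7.1, and the isotypical / `G`-simple decompositions following it; held copy
  `book:lange2022-decomposition-jacobians-by-prym-varieties`, PDF pp. 38–40). [LangeRodriguez2022]
-/

noncomputable section

universe u v

open CategoryTheory CategoryTheory.Limits AlgebraicGeometry

namespace Literature.AlgebraicGeometry.Motives

namespace AbelianVariety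

variable {K : Type u} [Field K] {R : Type v} [Semiring R]

/-- An `R`-simple `X` is its own equivariant decomposition: one piece `S = X` with the given
action, `ι = π = 𝟙`, `N = 1`. [folklore] -/
private theorem exists_equivariant_quasiDecomposition_of_simple (X : AbelianVariety K)
    (φ : R →+* End X)
    (hX : ∀ (W : AbelianVariety K) (ω : R →+* End W) (w : W ⟶ X),
      IsClosedImmersion (Hom.toSchemeHom w) →
      (∀ r : R, w ≫ End.asHom (φ r) = End.asHom (ω r) ≫ w) → 0 < W.dim → W.dim < X.dim → False) :
    ∃ (I : Type) (_ : Fintype I) (S : I → AbelianVariety K) (χ : ∀ i, R →+* End (S i))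
      (ι : ∀ i, S i ⟶ X) (π : ∀ i, X ⟶ S i) (N : ℕ),
      (∀ i, ∀ (W : AbelianVariety K) (ω : R →+* End W) (w : W ⟶ S i),
        IsClosedImmersion (Hom.toSchemeHom w) →
        (∀ r : R, w ≫ End.asHom (χ i r) = End.asHom (ω r) ≫ w) →
        0 < W.dim → W.dim < (S i).dim → False) ∧
      0 < N ∧ (∀ i, ι i ≫ π i = N • 𝟙 (S i)) ∧ (∀ i j, i ≠ j → ι i ≫ π j = 0) ∧
      ∑ i, π i ≫ ι i = N • 𝟙 X ∧
      (∀ i (r : R), ι i ≫ End.asHom (φ r) = End.asHom (χ i r) ≫ ι i) ∧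
      (∀ i (r : R), End.asHom (φ r) ≫ π i = π i ≫ End.asHom (χ i r)) :=
  ⟨Unit, inferInstance, fun _ ↦ X, fun _ ↦ φ, fun _ ↦ 𝟙 X, fun _ ↦ 𝟙 X, 1, fun _ ↦ hX, one_pos,
    fun _ ↦ by rw [Category.comp_id, one_smul],
    fun i j hij ↦ (hij (Subsingleton.elim i j)).elim,
    by rw [Fintype.sum_unique, Category.comp_id, one_smul],
    fun _ _ ↦ by rw [Category.id_comp, Category.comp_id],
    fun _ _ ↦ by rw [Category.id_comp, Category.comp_id]⟩

/-- **Merging step.** Equivariant decompositions `(ι¹, π¹, N₁)` of `Y` and `(ι², π², N₂)` of `Z`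
and an equivariant splitting `X ∼ Y ⊕ Z` (`i ≫ h = M`, `j ≫ t = M`, `i ≫ t = 0`, `j ≫ h = 0`,
`h ≫ i + t ≫ j = M`) merge into an equivariant decomposition of `X` indexed by `I₁ ⊕ I₂`:
`ι = N₂ (ι¹ ≫ i)` resp. `N₁ (ι² ≫ j)`, `π = h ≫ π¹` resp. `t ≫ π²`, `N = N₁ N₂ M`.
[cite: MumfordAV1970, §19 Thm. 1 and Cor. 1 (p. 173)] -/
private theorem exists_equivariant_quasiDecomposition_merge {X Y Z : AbelianVariety K}
    (φ : R →+* End X) (ψ : R →+* End Y) (χ : R →+* End Z)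
    {i : Y ⟶ X} {j : Z ⟶ X} {h : X ⟶ Y} {t : X ⟶ Z} {M : ℕ} (hM : 0 < M)
    (hih : i ≫ h = M • 𝟙 Y) (hjt : j ≫ t = M • 𝟙 Z) (hit : i ≫ t = 0) (hjh : j ≫ h = 0)
    (htot : h ≫ i + t ≫ j = M • 𝟙 X)
    (hi : ∀ r : R, i ≫ End.asHom (φ r) = End.asHom (ψ r) ≫ i)
    (hj : ∀ r : R, j ≫ End.asHom (φ r) = End.asHom (χ r) ≫ j)
    (hh : ∀ r : R, End.asHom (φ r) ≫ h = h ≫ End.asHom (ψ r))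
    (ht : ∀ r : R, End.asHom (φ r) ≫ t = t ≫ End.asHom (χ r))
    (P : ∀ (S : AbelianVariety K), (R →+* End S) → Prop)
    {I₁ : Type} [Fintype I₁] {S₁ : I₁ → AbelianVariety K} {χ₁ : ∀ a, R →+* End (S₁ a)}
    {ι₁ : ∀ a, S₁ a ⟶ Y} {π₁ : ∀ a, Y ⟶ S₁ a} {N₁ : ℕ} (hS₁ : ∀ a, P (S₁ a) (χ₁ a))
    (hN₁ : 0 < N₁) (h1₁ : ∀ a, ι₁ a ≫ π₁ a = N₁ • 𝟙 (S₁ a))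
    (h2₁ : ∀ a a', a ≠ a' → ι₁ a ≫ π₁ a' = 0) (h3₁ : ∑ a, π₁ a ≫ ι₁ a = N₁ • 𝟙 Y)
    (he₁ : ∀ a (r : R), ι₁ a ≫ End.asHom (ψ r) = End.asHom (χ₁ a r) ≫ ι₁ a)
    (hp₁ : ∀ a (r : R), End.asHom (ψ r) ≫ π₁ a = π₁ a ≫ End.asHom (χ₁ a r))
    {I₂ : Type} [Fintype I₂] {S₂ : I₂ → AbelianVariety K} {χ₂ : ∀ b, R →+* End (S₂ b)}
    {ι₂ : ∀ b, S₂ b ⟶ Z} {π₂ : ∀ b, Z ⟶ S₂ b} {N₂ : ℕ} (hS₂ : ∀ b, P (S₂ b) (χ₂ b))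
    (hN₂ : 0 < N₂) (h1₂ : ∀ b, ι₂ b ≫ π₂ b = N₂ • 𝟙 (S₂ b))
    (h2₂ : ∀ b b', b ≠ b' → ι₂ b ≫ π₂ b' = 0) (h3₂ : ∑ b, π₂ b ≫ ι₂ b = N₂ • 𝟙 Z)
    (he₂ : ∀ b (r : R), ι₂ b ≫ End.asHom (χ r) = End.asHom (χ₂ b r) ≫ ι₂ b)
    (hp₂ : ∀ b (r : R), End.asHom (χ r) ≫ π₂ b = π₂ b ≫ End.asHom (χ₂ b r)) :
    ∃ (I : Type) (_ : Fintype I) (S : I → AbelianVariety K) (χ' : ∀ c, R →+* End (S c))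
      (ι : ∀ c, S c ⟶ X) (π : ∀ c, X ⟶ S c) (N : ℕ),
      (∀ c, P (S c) (χ' c)) ∧ 0 < N ∧ (∀ c, ι c ≫ π c = N • 𝟙 (S c)) ∧
      (∀ c c', c ≠ c' → ι c ≫ π c' = 0) ∧ ∑ c, π c ≫ ι c = N • 𝟙 X ∧
      (∀ c (r : R), ι c ≫ End.asHom (φ r) = End.asHom (χ' c r) ≫ ι c) ∧
      (∀ c (r : R), End.asHom (φ r) ≫ π c = π c ≫ End.asHom (χ' c r)) := by
  refine ⟨I₁ ⊕ I₂, inferInstance, Sum.elim S₁ S₂,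
    fun c ↦ match c with
      | Sum.inl a => χ₁ a
      | Sum.inr b => χ₂ b,
    fun c ↦ match c with
      | Sum.inl a => N₂ • (ι₁ a ≫ i)
      | Sum.inr b => N₁ • (ι₂ b ≫ j),
    fun c ↦ match c with
      | Sum.inl a => h ≫ π₁ a
      | Sum.inr b => t ≫ π₂ b,
    N₁ * N₂ * M, ?_, Nat.mul_pos (Nat.mul_pos hN₁ hN₂) hM, ?_, ?_, ?_, ?_, ?_⟩
  · rintro (a | b)
    exacts [hS₁ a, hS₂ b]
  · rintro (a | b)
    · show (N₂ • (ι₁ a ≫ i)) ≫ h ≫ π₁ a = (N₁ * N₂ * M) • 𝟙 (S₁ a)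
      rw [Preadditive.nsmul_comp, Category.assoc, reassoc_of% hih, Preadditive.nsmul_comp,
        Category.id_comp, Preadditive.comp_nsmul, h1₁, smul_smul, smul_smul,
        show N₂ * M * N₁ = N₁ * N₂ * M by ring]
    · show (N₁ • (ι₂ b ≫ j)) ≫ t ≫ π₂ b = (N₁ * N₂ * M) • 𝟙 (S₂ b)
      rw [Preadditive.nsmul_comp, Category.assoc, reassoc_of% hjt, Preadditive.nsmul_comp,
        Category.id_comp, Preadditive.comp_nsmul, h1₂, smul_smul, smul_smul,
        show N₁ * M * N₂ = N₁ * N₂ * M by ring]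
  · rintro (a | b) (a' | b') hne
    · show (N₂ • (ι₁ a ≫ i)) ≫ h ≫ π₁ a' = 0
      have hne' : a ≠ a' := fun e ↦ hne (congrArg Sum.inl e)
      rw [Preadditive.nsmul_comp, Category.assoc, reassoc_of% hih, Preadditive.nsmul_comp,
        Category.id_comp, Preadditive.comp_nsmul, h2₁ a a' hne', smul_zero, smul_zero]
    · show (N₂ • (ι₁ a ≫ i)) ≫ t ≫ π₂ b' = 0
      rw [Preadditive.nsmul_comp, Category.assoc, reassoc_of% hit, zero_comp, comp_zero,
        smul_zero]
    · show (N₁ • (ι₂ b ≫ j)) ≫ h ≫ π₁ a' = 0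
      rw [Preadditive.nsmul_comp, Category.assoc, reassoc_of% hjh, zero_comp, comp_zero,
        smul_zero]
    · show (N₁ • (ι₂ b ≫ j)) ≫ t ≫ π₂ b' = 0
      have hne' : b ≠ b' := fun e ↦ hne (congrArg Sum.inr e)
      rw [Preadditive.nsmul_comp, Category.assoc, reassoc_of% hjt, Preadditive.nsmul_comp,
        Category.id_comp, Preadditive.comp_nsmul, h2₂ b b' hne', smul_zero, smul_zero]
  · rw [Fintype.sum_sum_type]
    show (∑ a, (h ≫ π₁ a) ≫ (N₂ • (ι₁ a ≫ i))) + ∑ b, (t ≫ π₂ b) ≫ (N₁ • (ι₂ b ≫ j)) =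
      (N₁ * N₂ * M) • 𝟙 X
    have e1 : ∑ a, (h ≫ π₁ a) ≫ (N₂ • (ι₁ a ≫ i)) = (N₁ * N₂) • (h ≫ i) := by
      have e : ∀ a, (h ≫ π₁ a) ≫ (N₂ • (ι₁ a ≫ i)) = N₂ • (h ≫ (π₁ a ≫ ι₁ a) ≫ i) := fun a ↦ by
        rw [Preadditive.comp_nsmul]
        simp only [Category.assoc]
      rw [Finset.sum_congr rfl fun a _ ↦ e a, ← Finset.smul_sum, ← Preadditive.comp_sum,
        ← Preadditive.sum_comp, h3₁, Preadditive.nsmul_comp, Category.id_comp,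
        Preadditive.comp_nsmul, smul_smul, mul_comm N₂ N₁]
    have e2 : ∑ b, (t ≫ π₂ b) ≫ (N₁ • (ι₂ b ≫ j)) = (N₁ * N₂) • (t ≫ j) := by
      have e : ∀ b, (t ≫ π₂ b) ≫ (N₁ • (ι₂ b ≫ j)) = N₁ • (t ≫ (π₂ b ≫ ι₂ b) ≫ j) := fun b ↦ by
        rw [Preadditive.comp_nsmul]
        simp only [Category.assoc]
      rw [Finset.sum_congr rfl fun b _ ↦ e b, ← Finset.smul_sum, ← Preadditive.comp_sum,
        ← Preadditive.sum_comp, h3₂, Preadditive.nsmul_comp, Category.id_comp,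
        Preadditive.comp_nsmul, smul_smul]
    rw [e1, e2, ← smul_add, htot, smul_smul]
  · rintro (a | b) r
    · show (N₂ • (ι₁ a ≫ i)) ≫ End.asHom (φ r) = End.asHom (χ₁ a r) ≫ (N₂ • (ι₁ a ≫ i))
      rw [Preadditive.nsmul_comp, Preadditive.comp_nsmul, Category.assoc, hi r, ← Category.assoc,
        he₁ a r, Category.assoc]
    · show (N₁ • (ι₂ b ≫ j)) ≫ End.asHom (φ r) = End.asHom (χ₂ b r) ≫ (N₁ • (ι₂ b ≫ j))
      rw [Preadditive.nsmul_comp, Preadditive.comp_nsmul, Category.assoc, hj r, ← Category.assoc,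
        he₂ b r, Category.assoc]
  · rintro (a | b) r
    · show End.asHom (φ r) ≫ h ≫ π₁ a = (h ≫ π₁ a) ≫ End.asHom (χ₁ a r)
      rw [← Category.assoc, hh r, Category.assoc, hp₁ a r, Category.assoc]
    · show End.asHom (φ r) ≫ t ≫ π₂ b = (t ≫ π₂ b) ≫ End.asHom (χ₂ b r)
      rw [← Category.assoc, ht r, Category.assoc, hp₂ b r, Category.assoc]

/-- **Complete reducibility up to isogeny with operators (Poincaré–Mumford with `R`-action).**
Let `R` be a semiring.  Suppose that over the field `K` every `R`-stable abelian subvariety splits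
off equivariantly up to isogeny (`hP`: for an abelian variety `X` with `R`-action `φ`, an abelian
variety `Y` with `R`-action `ψ` and an equivariant closed immersion `i : Y ↪ X` with
`0 < dim Y < dim X`, there are `Z` with `R`-action `χ` and `dim Z < dim X`, equivariant
`j : Z ⟶ X`, `h : X ⟶ Y`, `t : X ⟶ Z` and `M ≥ 1` with `i ≫ h = M`, `j ≫ t = M`, `i ≫ t = 0`,
`j ≫ h = 0`, `h ≫ i + t ≫ j = M`; over a perfect field this is Poincaré's theorem with operators,
`Motives/AbelianVarietyPoincareEquivariantPerfectField`).  Then every abelian variety `X` with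
`R`-action `φ : R →+* End X` admits finitely many abelian varieties `Sᵢ` with `R`-actions `χᵢ`,
each **`R`-simple** (no `R`-stable abelian subvariety `W ↪ Sᵢ`, `W` with an `R`-action making the
closed immersion equivariant, of dimension `0 < dim W < dim Sᵢ`), EQUIVARIANT morphisms
`ιᵢ : Sᵢ ⟶ X`, `πᵢ : X ⟶ Sᵢ` (`ιᵢ ≫ φ r = χᵢ r ≫ ιᵢ`, `φ r ≫ πᵢ = πᵢ ≫ χᵢ r`) and an integer
`N ≥ 1` with `ιᵢ ≫ πᵢ = N`, `ιᵢ ≫ πⱼ = 0` for `i ≠ j` and `∑ᵢ πᵢ ≫ ιᵢ = N`: `X` is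
`R`-isogenous to `⊕ᵢ Sᵢ`, the identities of the biproduct in the isogeny category multiplied
through by `N`. [cite: MumfordAV1970, §19 Thm. 1 and Cor. 1 (pp. 173–174)]
[cite: LangeRodriguez2022, §2.7 (Thm. 2.7.1 and the decompositions following it)] -/
theorem exists_equivariant_quasiDecomposition_of_splitting
    (hP : ∀ (X : AbelianVariety K) (φ : R →+* End X) (Y : AbelianVariety K) (ψ : R →+* End Y)
      (i : Y ⟶ X), IsClosedImmersion (Hom.toSchemeHom i) →
      (∀ r : R, i ≫ End.asHom (φ r) = End.asHom (ψ r) ≫ i) → 0 < Y.dim → Y.dim < X.dim →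
      ∃ (Z : AbelianVariety K) (χ : R →+* End Z) (j : Z ⟶ X) (h : X ⟶ Y) (t : X ⟶ Z) (M : ℕ),
        Z.dim < X.dim ∧ 0 < M ∧ i ≫ h = M • 𝟙 Y ∧ j ≫ t = M • 𝟙 Z ∧ i ≫ t = 0 ∧ j ≫ h = 0 ∧
        h ≫ i + t ≫ j = M • 𝟙 X ∧
        (∀ r : R, j ≫ End.asHom (φ r) = End.asHom (χ r) ≫ j) ∧
        (∀ r : R, End.asHom (φ r) ≫ h = h ≫ End.asHom (ψ r)) ∧
        (∀ r : R, End.asHom (φ r) ≫ t = t ≫ End.asHom (χ r)))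
    (X : AbelianVariety K) (φ : R →+* End X) :
    ∃ (I : Type) (_ : Fintype I) (S : I → AbelianVariety K) (χ : ∀ i, R →+* End (S i))
      (ι : ∀ i, S i ⟶ X) (π : ∀ i, X ⟶ S i) (N : ℕ),
      (∀ i, ∀ (W : AbelianVariety K) (ω : R →+* End W) (w : W ⟶ S i),
        IsClosedImmersion (Hom.toSchemeHom w) →
        (∀ r : R, w ≫ End.asHom (χ i r) = End.asHom (ω r) ≫ w) →
        0 < W.dim → W.dim < (S i).dim → False) ∧
      0 < N ∧ (∀ i, ι i ≫ π i = N • 𝟙 (S i)) ∧ (∀ i j, i ≠ j → ι i ≫ π j = 0) ∧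
      ∑ i, π i ≫ ι i = N • 𝟙 X ∧
      (∀ i (r : R), ι i ≫ End.asHom (φ r) = End.asHom (χ i r) ≫ ι i) ∧
      (∀ i (r : R), End.asHom (φ r) ≫ π i = π i ≫ End.asHom (χ i r)) := by
  obtain ⟨n, hn⟩ : ∃ n, X.dim ≤ n := ⟨_, le_rfl⟩
  induction n generalizing X with
  | zero =>
    exact exists_equivariant_quasiDecomposition_of_simple X φ fun _ _ _ _ _ h0 hlt ↦ by omega
  | succ n ih =>
    by_cases hs : ∀ (W : AbelianVariety K) (ω : R →+* End W) (w : W ⟶ X),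
      IsClosedImmersion (Hom.toSchemeHom w) →
      (∀ r : R, w ≫ End.asHom (φ r) = End.asHom (ω r) ≫ w) → 0 < W.dim → W.dim < X.dim → False
    · exact exists_equivariant_quasiDecomposition_of_simple X φ hs
    obtain ⟨Y, ψ, i, hci, hi, h0, hlt⟩ : ∃ (Y : AbelianVariety K) (ψ : R →+* End Y) (i : Y ⟶ X),
        IsClosedImmersion (Hom.toSchemeHom i) ∧
        (∀ r : R, i ≫ End.asHom (φ r) = End.asHom (ψ r) ≫ i) ∧ 0 < Y.dim ∧ Y.dim < X.dim := by
      by_contra hc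
      exact hs fun W ω w hw hwe h0' hlt' ↦ hc ⟨W, ω, w, hw, hwe, h0', hlt'⟩
    obtain ⟨Z, χ, j, h, t, M, hZ, hM, hih, hjt, hit, hjh, htot, hj, hh, ht⟩ :=
      hP X φ Y ψ i hci hi h0 hlt
    obtain ⟨I₁, _, S₁, χ₁, ι₁, π₁, N₁, hS₁, hN₁, h1₁, h2₁, h3₁, he₁, hp₁⟩ := ih Y ψ (by omega)
    obtain ⟨I₂, _, S₂, χ₂, ι₂, π₂, N₂, hS₂, hN₂, h1₂, h2₂, h3₂, he₂, hp₂⟩ := ih Z χ (by omega)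
    exact exists_equivariant_quasiDecomposition_merge φ ψ χ hM hih hjt hit hjh htot hi hj hh ht
      (fun S (χ' : R →+* End S) ↦ ∀ (W : AbelianVariety K) (ω : R →+* End W) (w : W ⟶ S),
        IsClosedImmersion (Hom.toSchemeHom w) →
        (∀ r : R, w ≫ End.asHom (χ' r) = End.asHom (ω r) ≫ w) → 0 < W.dim → W.dim < S.dim →
        False)
      hS₁ hN₁ h1₁ h2₁ h3₁ he₁ hp₁ hS₂ hN₂ h1₂ h2₂ h3₂ he₂ hp₂

end AbelianVariety

end Literature.AlgebraicGeometry.Motives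

end
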